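import Summits.RiemannHypothesis.RiemannHypothesis.Theorems.GroundBartaEvenWinsBeyondArchCellsUpTo80
import Summits.RiemannHypothesis.RiemannHypothesis.Theorems.GroundBartaEvenWinsBeyondArchUpper80Sharp
import Summits.RiemannHypothesis.RiemannHypothesis.Theorems.GroundBartaEvenWinsBeyondArchDeflationConsequences
import Literature.NumberTheory.LFunctions.WeilGroundEnergyParitySplit
import HarnessLib

/-!
# RiemannHypothesis / GroundBarta — rung 4: the ENDPOINT CELL `[4023/5000, (log 5)/2]` of the parity ladder and
# Weil positivity on the COMPLETE three-prime window, from the two sector blocks at `(log 5)/2`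

Helper file (`--supports stmt-RiemannHypothesis-18085`), RH-free, pure logic (prover A g10; the cell template of
`…Frontier80OfOddLower` / `…CellsUpTo80` / `…Positivity8046`).  The three-prime window ends at `a* = (log 5)/2 = 0.80471895…`
(`weilPrimeIndex a* = {0,…,4}`); the tree's parity and positivity frontiers are both at `4023/5000 = 0.8046`.  This file
states what the two deflated Temple blocks AT THE ENDPOINT deliver, as implications from their conclusions (the blocks
themselves — β-certificate, A-layer, R-layer, shell bound at the irrational window — are landed separately):

* `weilWindowSimpleEven_on_cell_log5half_of_oddLower` — with the sharp U-side `trialUpper80sharp : ε(4023/5000) ≤ 10⁻¹⁷`,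
  one odd lower bound `10⁻¹⁷ < L ≤ ε_od((log 5)/2)` gives `WeilWindowSimpleEven a` on the whole cell `[4023/5000, (log 5)/2]`
  (cell transfer `GroundStateSimpleEven.weilWindowSimpleEven_on_cell_of_le`);
* `weilWindowSimpleEven_upTo_log5half_of_oddLower` — hence on `(0, (log 5)/2]` (with `weilWindowSimpleEven_upTo_M80`);
* `weilPositivityOn_log5half_of_blocks` — `0 ≤ ε_ev((log 5)/2)` and `0 ≤ ε_od((log 5)/2)` give
  `WeilPositivityOn ((log 5)/2)` (`dt_weilPositivityOn`), i.e. Weil positivity for every test function supported in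
  the closed three-prime window, and `weilGroundEnergy_log5half_nonneg_of_blocks`.
-/

set_option linter.dupNamespace false

noncomputable section

open Set MeasureTheory

namespace Summit.RiemannHypothesis.RiemannHypothesis.Theorems.EvenWinsBeyondArch

open Literature.NumberTheory.LFunctions

/-- `4023/5000 ≤ (log 5)/2`. [folklore] -/
theorem m80_le_log5half : (4023 / 5000 : ℝ) ≤ Real.log 5 / 2 := by
  have h := m80_le_log5; push_cast at h; exact h

/-- **The endpoint cell `[4023/5000, (log 5)/2]`**: `10⁻¹⁷ < L ≤ ε_od((log 5)/2) ⟹ WeilWindowSimpleEven a` for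
`a ∈ [4023/5000, (log 5)/2]`. [folklore] -/
theorem weilWindowSimpleEven_on_cell_log5half_of_oddLower {L : ℝ} (hUL : (1 / 100000000000000000 : ℝ) < L)
    (hL : L ≤ weilOddGroundEnergy (Real.log 5 / 2)) {a : ℝ} (hlo : (4023 / 5000 : ℝ) ≤ a) (hhi : a ≤ Real.log 5 / 2) :
    WeilWindowSimpleEven a :=
  GroundStateSimpleEven.weilWindowSimpleEven_on_cell_of_le (b := (4023 / 5000 : ℝ)) (c := Real.log 5 / 2) (by norm_num) hUL
    trialUpper80sharp (fun _ hg hs hn ho ↦ hL.trans (weilOddGroundEnergy_le hg hs ho hn)) hlo hhi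

/-- **`WeilWindowSimpleEven` on `(0, (log 5)/2]`** from the landed ladder up to `4023/5000` and one odd-sector lower bound at
the endpoint. [folklore] -/
theorem weilWindowSimpleEven_upTo_log5half_of_oddLower {L : ℝ} (hUL : (1 / 100000000000000000 : ℝ) < L)
    (hL : L ≤ weilOddGroundEnergy (Real.log 5 / 2)) :
    ∀ a : ℝ, 0 < a → a ≤ Real.log 5 / 2 → WeilWindowSimpleEven a := by
  intro a ha hle
  rcases le_or_gt a (4023 / 5000) with h | h
  · exact weilWindowSimpleEven_upTo_M80 a ha h
  · exact weilWindowSimpleEven_on_cell_log5half_of_oddLower hUL hL h.le hle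

/-- Tail shape of item 18085 up to `(log 5)/2`, from the odd endpoint block. [folklore] -/
theorem tailSimpleEven_upTo_log5half_of_oddLower {L : ℝ} (hUL : (1 / 100000000000000000 : ℝ) < L)
    (hL : L ≤ weilOddGroundEnergy (Real.log 5 / 2)) :
    ∀ a : ℝ, Real.log 2 < a → a ≤ Real.log 5 / 2 → WeilWindowSimpleEven a :=
  fun a ha hle ↦ weilWindowSimpleEven_upTo_log5half_of_oddLower hUL hL a ((Real.log_pos (by norm_num)).trans ha) hle

/-- **Weil positivity on the closed three-prime window from the two endpoint blocks**: `0 ≤ ε_ev((log 5)/2)` and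
`0 ≤ ε_od((log 5)/2)` give `WeilPositivityOn ((log 5)/2)`. [folklore] -/
theorem weilPositivityOn_log5half_of_blocks (hE : 0 ≤ weilEvenGroundEnergy (Real.log 5 / 2))
    (hO : 0 ≤ weilOddGroundEnergy (Real.log 5 / 2)) : WeilPositivityOn (Real.log 5 / 2) :=
  dt_weilPositivityOn hE hO

/-- The bottom of Weil's form on the closed three-prime window is non-negative, from the two blocks. [folklore] -/
theorem weilGroundEnergy_log5half_nonneg_of_blocks (hE : 0 ≤ weilEvenGroundEnergy (Real.log 5 / 2))
    (hO : 0 ≤ weilOddGroundEnergy (Real.log 5 / 2)) : 0 ≤ weilGroundEnergy (Real.log 5 / 2) := by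
  rw [weilGroundEnergy_eq_min_even_odd]
  exact le_min hE hO

/-- Weil positivity on every window `a ≤ (log 5)/2`, from the two blocks. [folklore] -/
theorem weilPositivityOn_of_le_log5half_of_blocks (hE : 0 ≤ weilEvenGroundEnergy (Real.log 5 / 2))
    (hO : 0 ≤ weilOddGroundEnergy (Real.log 5 / 2)) {a : ℝ} (ha : a ≤ Real.log 5 / 2) : WeilPositivityOn a :=
  (weilPositivityOn_log5half_of_blocks hE hO).mono ha

end Summit.RiemannHypothesis.RiemannHypothesis.Theorems.EvenWinsBeyondArch

end
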